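import Summits.Ventures.PercRepro.SixThreeSmall
import Summits.Ventures.PercRepro.SixThreeCounts

/-!
# PercRepro — the profile lower bound `Σ_{B ∈ R₃(G)} v(B, n) ≥ F(n, g, profile)` (p2, gen 6)

mine-2 `MINE2-RLS.md` §19.7 Steps 1–3 / §19.9: the supply `v(B, n) = vFun n |B| Λ(B)` of a rank-`3` subset `B` of a
plane `G` is antitone in `Λ(B)`, and `Λ(B)` is bounded by the TYPE of `B` (`b = |B|`, `k` = points of `B` on its
longest line): `b = 3`: `Λ = 3`; `b = 4`: `Λ = 6` (generic) or `≤ 9` (3-line + point); `b ≥ 5`: `k = b − 1` («lp»):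
`Λ ≤ 6^{b−3} + b − 1`; `k = b − 2`: `Λ ≤ 6^{b−4} + 2b`; `k ≤ b − 3` («rest»): `Λ ≤ 6^{b−5} C(b,2)/C(b−3,2)` (`b ≥ 6`),
`Λ = 10` (`b = 5`).  The numbers of sets of each type are functions of the LINE PROFILE `{m_ℓ ≥ 3}` of `G`
(`SixThreeCounts.lean`), so `Σ_B v(B, n) ≥ Fsum n g (prof M G)` with `Fsum` an explicit function of `n`, `g` and the
profile multiset — the object of p3's additive table (`A_t(g) + Σ_ℓ B_t(g, m_ℓ)`).
-/

namespace PercRepro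

namespace SixThree

open Finset ThmH

variable {α : Type*} [DecidableEq α] {M : Matroid α} [M.Finite]

/-! ### `vFun` -/

/-- `v(n, b, Λ) = n · 6^{b−3}/(6^{b−3}+Λ) + (2n−3) · 6^{b−3}/(6^{b−3}+2Λ+b) + C(n−2,2) · 6^{b−3}/(6^{b−3}+6Λ+b)`. -/
noncomputable def vFun (n b : ℕ) (Λ : ℚ) : ℚ :=
  n * ((6 : ℚ) ^ (b - 3) / ((6 : ℚ) ^ (b - 3) + Λ)) +
    (2 * (n : ℚ) - 3) * ((6 : ℚ) ^ (b - 3) / ((6 : ℚ) ^ (b - 3) + 2 * Λ + b)) +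
    (((n - 2).choose 2 : ℕ) : ℚ) * ((6 : ℚ) ^ (b - 3) / ((6 : ℚ) ^ (b - 3) + 6 * Λ + b))

/-- `vSupply M B n = vFun n |B| Λ(B)` for `|B| ≠ 3` (a triple uses the exact parallel share `1/15`). -/
theorem vSupply_eq_vFun (M : Matroid α) [M.Finite] {B : Finset α} (h3 : B.card ≠ 3) (n : ℕ) :
    vSupply M B n = vFun n B.card (Lam M B) := by
  unfold vSupply vFun w₁ w₂ w₂m
  rw [if_neg h3]

/-- `v(n, 3, Λ = 3)` with the exact triple shares `1/4, 1/10, 1/15`. -/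
noncomputable def vTriExact (n : ℕ) : ℚ :=
  n * (1 / 4 : ℚ) + (2 * (n : ℚ) - 3) * (1 / 10 : ℚ) + (((n - 2).choose 2 : ℕ) : ℚ) * (1 / 15 : ℚ)

/-- `vSupply M T n = vTriExact n` for a rank-`3` triple `T` of the ground set. -/
theorem vSupply_triple (hs : Simple M) {T : Finset α} (hT : T ⊆ gr M) (hrT : M.eRk (T : Set α) = 3)
    (hT3 : T.card = 3) (n : ℕ) : vSupply M T n = vTriExact n := by
  unfold vSupply vTriExact w₁ w₂ w₂m
  rw [if_pos hT3, hT3, Lam_triple hs hT hrT hT3]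
  norm_num

/-- `vFun` is antitone in `Λ ≥ 0` (for `n ≥ 2`). -/
theorem vFun_antitone {n b : ℕ} (hn : 2 ≤ n) {Λ Λ' : ℚ} (h0 : 0 ≤ Λ) (h : Λ ≤ Λ') :
    vFun n b Λ' ≤ vFun n b Λ := by
  unfold vFun
  have h1 : (0 : ℚ) ≤ (6 : ℚ) ^ (b - 3) := by positivity
  have h2 : (0 : ℚ) ≤ (b : ℚ) := by positivity
  have hn' : (0 : ℚ) ≤ 2 * (n : ℚ) - 3 := by
    have : (2 : ℚ) ≤ n := by exact_mod_cast hn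
    linarith
  have hc : (0 : ℚ) ≤ (((n - 2).choose 2 : ℕ) : ℚ) := by positivity
  have e1 : (6 : ℚ) ^ (b - 3) / ((6 : ℚ) ^ (b - 3) + Λ') ≤ (6 : ℚ) ^ (b - 3) / ((6 : ℚ) ^ (b - 3) + Λ) :=
    div_le_div_of_nonneg_left h1 (by positivity) (by linarith)
  have e2 : (6 : ℚ) ^ (b - 3) / ((6 : ℚ) ^ (b - 3) + 2 * Λ' + b) ≤
      (6 : ℚ) ^ (b - 3) / ((6 : ℚ) ^ (b - 3) + 2 * Λ + b) :=
    div_le_div_of_nonneg_left h1 (by positivity) (by linarith)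
  have e3 : (6 : ℚ) ^ (b - 3) / ((6 : ℚ) ^ (b - 3) + 6 * Λ' + b) ≤
      (6 : ℚ) ^ (b - 3) / ((6 : ℚ) ^ (b - 3) + 6 * Λ + b) :=
    div_le_div_of_nonneg_left h1 (by positivity) (by linarith)
  have hnq : (0 : ℚ) ≤ n := by positivity
  nlinarith [mul_le_mul_of_nonneg_left e1 hnq, mul_le_mul_of_nonneg_left e2 hn', mul_le_mul_of_nonneg_left e3 hc]

/-- A `Λ`-bound gives a `vSupply` lower bound (`|B| ≠ 3`). -/
theorem vSupply_ge_of_Lam_le (M : Matroid α) [M.Finite] {B : Finset α} (h3 : B.card ≠ 3) {n : ℕ} (hn : 2 ≤ n)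
    {Λ' : ℚ} (h : Lam M B ≤ Λ') : vFun n B.card Λ' ≤ vSupply M B n := by
  rw [vSupply_eq_vFun M h3]
  exact vFun_antitone hn (Lam_nonneg M B) h

/-! ### The profile and the count formulas -/

/-- The line profile of `G`: the multiset of sizes `|L ∩ G| ≥ 3` of the lines of `M|G`. -/
noncomputable def prof (M : Matroid α) [M.Finite] (G : Finset α) : Multiset ℕ :=
  (((linesOf M G).filter (fun L => 3 ≤ (L ∩ G).card)).val).map (fun L => (L ∩ G).card)

/-- `Σ_{m ∈ prof} f m = Σ_{L ∈ linesOf G} f |L ∩ G|` whenever `f 2 = 0`. -/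
theorem sum_prof_eq (G : Finset α) (f : ℕ → ℕ) (hf : f 2 = 0) :
    (Multiset.map f (prof M G)).sum = ∑ L ∈ linesOf M G, f (L ∩ G).card := by
  unfold prof
  rw [Multiset.map_map]
  have : (Multiset.map (f ∘ fun L => (L ∩ G).card) ((linesOf M G).filter (fun L => 3 ≤ (L ∩ G).card)).val).sum =
      ∑ L ∈ (linesOf M G).filter (fun L => 3 ≤ (L ∩ G).card), f (L ∩ G).card := rfl
  rw [this, Finset.sum_filter]
  apply Finset.sum_congr rfl
  intro L hL
  by_cases h3 : 3 ≤ (L ∩ G).card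
  · rw [if_pos h3]
  · rw [if_neg h3]
    have h2 : 2 ≤ (L ∩ G).card := (Finset.mem_filter.1 hL).2
    have : (L ∩ G).card = 2 := by omega
    rw [this, hf]

/-- `N_s(g, P) = C(g, s) − Σ_{m ∈ P} C(m, s)` as a natural number (the rank-`3` `s`-subsets, `s ≥ 3`). -/
def Ns (g : ℕ) (P : Multiset ℕ) (s : ℕ) : ℕ := g.choose s - (Multiset.map (fun m => m.choose s) P).sum

/-- `lp_s(g, P) = Σ_{m ∈ P} (g − m) · C(m, s − 1)` (the «line + point» `s`-sets, `s ≥ 4`). -/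
def lps (g : ℕ) (P : Multiset ℕ) (s : ℕ) : ℕ := (Multiset.map (fun m => (g - m) * m.choose (s - 1)) P).sum

/-- `d_s(g, P) = min(Σ_{m ∈ P} C(m, s − 2) · C(g − m, 2), N_s − lp_s)` (the `(s − 2)`-type `s`-sets, `s ≥ 5`). -/
def ds (g : ℕ) (P : Multiset ℕ) (s : ℕ) : ℕ :=
  min ((Multiset.map (fun m => m.choose (s - 2) * (g - m).choose 2) P).sum) (Ns g P s - lps g P s)

/-- The «rest» count `N_s − lp_s − d_s`. -/
def rests (g : ℕ) (P : Multiset ℕ) (s : ℕ) : ℕ := Ns g P s - lps g P s - ds g P s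

/-- The type values of §19.9 (`θ = 6`): the triple with its exact shares `1/4, 1/10, 1/15`. -/
noncomputable def vTri (n : ℕ) : ℚ := vTriExact n
/-- Generic `4`-set. -/
noncomputable def v4gen (n : ℕ) : ℚ := vFun n 4 6
/-- `3`-line + point. -/
noncomputable def v4col (n : ℕ) : ℚ := vFun n 4 9
/-- The `Λ`-bounds of the three types at size `s ≥ 5`. -/
noncomputable def Llp (s : ℕ) : ℚ := (6 : ℚ) ^ (s - 3) + ((s : ℚ) - 1)
/-- `(s − 2)`-type. -/
noncomputable def Ld (s : ℕ) : ℚ := (6 : ℚ) ^ (s - 4) + 2 * s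
/-- Rest type: `6^{s−5} C(s,2)/C(s−3,2)` (`= 10` at `s = 5`). -/
noncomputable def Lrest (s : ℕ) : ℚ := (6 : ℚ) ^ (s - 5) * (s.choose 2 : ℕ) / ((s - 3).choose 2 : ℕ)
/-- Line + point (`s ≥ 5`). -/
noncomputable def vlp (n s : ℕ) : ℚ := vFun n s (Llp s)
/-- `(s − 2)`-type (`s ≥ 5`). -/
noncomputable def vd (n s : ℕ) : ℚ := vFun n s (Ld s)
/-- Rest type value. -/
noncomputable def vrest (n s : ℕ) : ℚ := vFun n s (Lrest s)

/-- `F(n, g, P) = T·v^{tri} + N₄^g·v^{4gen} + N₄^c·v^{4col} + Σ_{s=5}^{g} [lp_s·v^{lp} + d_s·v^{d} + rest_s·v^{rest}]`. -/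
noncomputable def Fsum (n g : ℕ) (P : Multiset ℕ) : ℚ :=
  (Ns g P 3 : ℚ) * vTri n + ((Ns g P 4 - lps g P 4 : ℕ) : ℚ) * v4gen n + (lps g P 4 : ℚ) * v4col n +
    ∑ s ∈ Finset.Icc 5 g, ((lps g P s : ℚ) * vlp n s + (ds g P s : ℚ) * vd n s + (rests g P s : ℚ) * vrest n s)

/-! ### The per-size lower bounds -/

/-- The rank-`3` `s`-subsets of `G`. -/
noncomputable def R3s (M : Matroid α) [M.Finite] (G : Finset α) (s : ℕ) : Finset (Finset α) :=
  (G.powersetCard s).filter (fun X : Finset α => M.eRk ((X : Finset α) : Set α) = 3)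

/-- `#R3s = N_s(g, prof)` for `s ≥ 3`. -/
theorem card_R3s (hs : Simple M) {G : Finset α} (hG : G ∈ planes M) {s : ℕ} (hs3 : 3 ≤ s) :
    (R3s M G s).card = Ns G.card (prof M G) s := by
  have hGg : G ⊆ gr M := (mem_planes.1 hG).1
  have h := card_rank_three_subsets_add hs hGg (mem_planes.1 hG).2.2 (s := s) (by omega)
  have hp := sum_prof_eq (M := M) G (fun m => m.choose s) (Nat.choose_eq_zero_of_lt (by omega))
  unfold Ns R3s
  rw [hp]
  omega

/-- **Size `3`**: every rank-`3` triple has `Λ = 3`, so the size-`3` sum is exactly `T · v^{tri}`. -/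
theorem sum_R3s_three (hs : Simple M) {G : Finset α} (hG : G ∈ planes M) (n : ℕ) :
    ∑ B ∈ R3s M G 3, vSupply M B n = (Ns G.card (prof M G) 3 : ℚ) * vTri n := by
  have hGg : G ⊆ gr M := (mem_planes.1 hG).1
  have hterm : ∀ B ∈ R3s M G 3, vSupply M B n = vTri n := by
    intro B hB
    unfold R3s at hB
    rw [Finset.mem_filter, Finset.mem_powersetCard] at hB
    exact vSupply_triple hs (hB.1.1.trans hGg) hB.2 hB.1.2 n
  rw [Finset.sum_congr rfl hterm, Finset.sum_const, nsmul_eq_mul, card_R3s hs hG (le_refl 3)]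

/-- A line of `M|B` (`B ⊆ G`) with `≥ 3` points of `B` is a line of `M|G` with those points. -/
theorem linesOf_mono {G B L : Finset α} (hB : B ⊆ G) (hL : L ∈ linesOf M B) : L ∈ linesOf M G := by
  unfold linesOf at hL ⊢
  rw [Finset.mem_filter] at hL ⊢
  exact ⟨hL.1, hL.2.trans (Finset.card_le_card (Finset.inter_subset_inter (Finset.Subset.refl _) hB))⟩

/-- A rank-`3` `4`-set with no `3` collinear points has `Λ = 6` (its six pairs are its lines). -/
theorem Lam_four_generic (hs : Simple M) {G B : Finset α} (hG : G ∈ planes M) (hB : B ⊆ G)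
    (hrB : M.eRk (B : Set α) = 3) (hB4 : B.card = 4)
    (hgen : ¬ ∃ L ∈ linesOf M G, (L ∩ B).card = 3) : Lam M B = 6 := by
  have hGg : G ⊆ gr M := (mem_planes.1 hG).1
  have hk : ∀ L ∈ linesOf M B, (L ∩ B).card = 2 := by
    intro L hL
    have h2 : 2 ≤ (L ∩ B).card := (Finset.mem_filter.1 hL).2
    have hle := card_inter_le_of_linesOf hrB hL
    by_contra hne
    exact hgen ⟨L, linesOf_mono hB hL, by omega⟩
  have hsum := sum_choose_linesOf hs (hB.trans hGg)
  rw [hB4, show Nat.choose 4 2 = 6 by decide] at hsum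
  unfold Lam
  have hterm : ∀ L ∈ linesOf M B, (6 : ℚ) ^ ((L ∩ B).card - 2) = (((L ∩ B).card.choose 2 : ℕ) : ℚ) := by
    intro L hL
    rw [hk L hL]
    norm_num
  rw [Finset.sum_congr rfl hterm, ← Nat.cast_sum, hsum]
  norm_num

/-- The «line + point» `s`-sets of `G` all have rank `3` (`s ≥ 3`), so `#(R3s ∩ lp) = lp_s(g, prof)` for `s ≥ 4`. -/
theorem card_R3s_lp (hs : Simple M) {G : Finset α} (hG : G ∈ planes M) {s : ℕ} (hs4 : 4 ≤ s) :
    ((R3s M G s).filter (fun B : Finset α => ∃ L ∈ linesOf M G, (L ∩ B).card = s - 1)).card =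
      lps G.card (prof M G) s := by
  have heq : (R3s M G s).filter (fun B : Finset α => ∃ L ∈ linesOf M G, (L ∩ B).card = s - 1) =
      (G.powersetCard s).filter (fun X : Finset α => ∃ L ∈ linesOf M G, (L ∩ X).card = s - 1) := by
    ext X
    unfold R3s
    rw [Finset.mem_filter, Finset.mem_filter, Finset.mem_filter, Finset.mem_powersetCard]
    constructor
    · rintro ⟨⟨hX, -⟩, hlp⟩
      exact ⟨hX, hlp⟩
    · rintro ⟨hX, L, hL, hLX⟩
      refine ⟨⟨hX, eRk_eq_three_of_lp hs hG hX.1 hL (by omega) hX.2 hLX⟩, L, hL, hLX⟩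
  rw [heq, card_lp_subsets hs hs4]
  unfold lps
  rw [sum_prof_eq (M := M) G (fun m => (G.card - m) * m.choose (s - 1))
    (by rw [Nat.choose_eq_zero_of_lt (by omega)]; ring)]

/-- **Size `4`**: `Σ_{B ∈ R₃, |B| = 4} v(B, n) ≥ (N₄ − lp₄) · v^{4gen} + lp₄ · v^{4col}`. -/
theorem sum_R3s_four (hs : Simple M) {G : Finset α} (hG : G ∈ planes M) {n : ℕ} (hn : 2 ≤ n) :
    ((Ns G.card (prof M G) 4 - lps G.card (prof M G) 4 : ℕ) : ℚ) * v4gen n +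
      (lps G.card (prof M G) 4 : ℚ) * v4col n ≤ ∑ B ∈ R3s M G 4, vSupply M B n := by
  classical
  have hGg : G ⊆ gr M := (mem_planes.1 hG).1
  rw [← Finset.sum_filter_add_sum_filter_not (R3s M G 4)
    (fun B : Finset α => ∃ L ∈ linesOf M G, (L ∩ B).card = 3)]
  have hcol : ∀ B ∈ (R3s M G 4).filter (fun B : Finset α => ∃ L ∈ linesOf M G, (L ∩ B).card = 3),
      v4col n ≤ vSupply M B n := by
    intro B hB
    rw [Finset.mem_filter] at hB
    unfold R3s at hB
    rw [Finset.mem_filter, Finset.mem_powersetCard] at hB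
    have hΛ := Lam_le hs (hB.1.1.1.trans hGg) hB.1.2 (by rw [hB.1.1.2])
    rw [hB.1.1.2] at hΛ
    have := vSupply_ge_of_Lam_le M (by rw [hB.1.1.2]; norm_num) hn hΛ
    rw [hB.1.1.2] at this
    unfold v4col
    norm_num at this ⊢
    exact this
  have hgen : ∀ B ∈ (R3s M G 4).filter (fun B : Finset α => ¬ ∃ L ∈ linesOf M G, (L ∩ B).card = 3),
      v4gen n ≤ vSupply M B n := by
    intro B hB
    rw [Finset.mem_filter] at hB
    unfold R3s at hB
    rw [Finset.mem_filter, Finset.mem_powersetCard] at hB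
    have hΛ := Lam_four_generic hs hG hB.1.1.1 hB.1.2 hB.1.1.2 hB.2
    have := vSupply_ge_of_Lam_le M (by rw [hB.1.1.2]; norm_num) hn hΛ.le
    rw [hB.1.1.2] at this
    exact this
  have hcard := card_R3s_lp hs hG (s := 4) (le_refl 4)
  have hN := card_R3s hs hG (s := 4) (by norm_num)
  have hsplit := Finset.card_filter_add_card_filter_not (s := R3s M G 4)
    (p := fun B : Finset α => ∃ L ∈ linesOf M G, (L ∩ B).card = 3)
  rw [show (4 : ℕ) - 1 = 3 from rfl] at hcard
  rw [hcard, hN] at hsplit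
  have hgencard : ((R3s M G 4).filter (fun B : Finset α => ¬ ∃ L ∈ linesOf M G, (L ∩ B).card = 3)).card =
      Ns G.card (prof M G) 4 - lps G.card (prof M G) 4 := by omega
  calc ((Ns G.card (prof M G) 4 - lps G.card (prof M G) 4 : ℕ) : ℚ) * v4gen n +
        (lps G.card (prof M G) 4 : ℚ) * v4col n
      = ∑ _B ∈ (R3s M G 4).filter (fun B : Finset α => ∃ L ∈ linesOf M G, (L ∩ B).card = 3), v4col n +
        ∑ _B ∈ (R3s M G 4).filter (fun B : Finset α => ¬ ∃ L ∈ linesOf M G, (L ∩ B).card = 3), v4gen n := by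
        rw [Finset.sum_const, Finset.sum_const, nsmul_eq_mul, nsmul_eq_mul, hcard, hgencard]
        ring
    _ ≤ _ := add_le_add (Finset.sum_le_sum hcol) (Finset.sum_le_sum hgen)


end SixThree

end PercRepro
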